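import Literature.IUT.HodgeTheaters.Labels

/-!
# Kernel DAG index — layer L5, part a (MACHINE DRAFT by abc-iut-dag `tools/mkkernel.py`, index v0 of plan/DAG.tsv @2026-08-25T18:35Z, 4 nodes)

THIS FILE PROVES NOTHING NEW AND ASSERTS NOTHING (plan/KERNEL-DAG-SPEC.md). It gives ONE NAME `N_<kernel_id>` to each DAG node whose
statement has LANDED through the gate, knitting the landed declarations BY NAME; `N_<id>_holds` exists iff the node's printed claims are
theorems OUR kernel checked (it IS those theorems); FACT-style `def … : Prop` claims and `@[claim … "disputed"]` items get a name and no
`_holds`. Nothing here says abc is proved or refuted or takes a side on [IUTchIII] Cor 3.12. typed ≠ discharged; indexed ≠ endorsed.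
Filer of the tree copy: abc-iut-c312-2 (`Summits/ABC/IUTFork/DAGL5a.lean`); this draft is regenerated hourly and is not the tree.
FILED COPY (abc-iut-c312-2, post-processed by work/fixdraft.py): claim nodes are claim-form abbrevs without `_holds`;
`_holds` only for DAG rows marked discharged, `_part` otherwise (spec §2(b),(c)); edges by name (§3).
-/

namespace Summit.ABC.IUTFork.DAG

namespace PartL5a
/-- `StatementOf h` is the statement (a `Prop`) of which the landed `h` is the proof: the index NAMES statements, it never re-types them. -/
abbrev StatementOf {P : Prop} (_h : P) : Prop := P
end PartL5a
open PartL5a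

noncomputable section
universe u₁ u₂ u₃ u₄ u₅ u₆ u₇ u₈ u₉

/-- [node IUTchI:Def4.1(ii) · L5/D2 · [IUTchI] Def 4.1 (ii), kurims p.95 · p403780 · data] decls 1 · cites→ IUTchI:Cor1.2,IUTchI:Def3.1,IUTchI:Ex3.2,IUTchI:Ex3.4,IUTchI:Rmk1.2.2,IUTchI:Rmk3.1.2 -/
abbrev N_IUTchI_Def4_1_ii := @Literature.IUT.HodgeTheaters.IsTorsor

/-- [node IUTchI:Prop4.2 · L5/D2 · [IUTchI] Prop 4.2, kurims p.98 · p403780 · claim] decls 8 · cites→ IUTchI:Def4.1 -/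
def N_IUTchI_Prop4_2 : Prop :=
  StatementOf @Literature.IUT.HodgeTheaters.IsTorsor.labelEquiv_self.{u₁, u₂} ∧
  StatementOf @Literature.IUT.HodgeTheaters.IsTorsor.pointedEquiv_apply.{u₁, u₂, u₃} ∧
  StatementOf @Literature.IUT.HodgeTheaters.IsTorsor.pointedEquiv_self.{u₁, u₂, u₃} ∧
  StatementOf @Literature.IUT.HodgeTheaters.IsTorsor.pointedEquiv_smul.{u₁, u₂, u₃} ∧
  StatementOf @Literature.IUT.HodgeTheaters.IsTorsor.existsUnique_pointed_equiv.{u₁, u₂, u₃} ∧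
  StatementOf @Literature.IUT.HodgeTheaters.IsTorsor.pointedEquiv_trans.{u₁, u₂, u₃, u₄}
/-- partial witness (DAG row not marked discharged) of `N_IUTchI_Prop4_2`: the landed theorems it names, BY NAME (spec §2(c)); proves nothing new. -/
theorem N_IUTchI_Prop4_2_part : N_IUTchI_Prop4_2 := ⟨@Literature.IUT.HodgeTheaters.IsTorsor.labelEquiv_self, @Literature.IUT.HodgeTheaters.IsTorsor.pointedEquiv_apply, @Literature.IUT.HodgeTheaters.IsTorsor.pointedEquiv_self, @Literature.IUT.HodgeTheaters.IsTorsor.pointedEquiv_smul, @Literature.IUT.HodgeTheaters.IsTorsor.existsUnique_pointed_equiv, @Literature.IUT.HodgeTheaters.IsTorsor.pointedEquiv_trans⟩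
example := @Literature.IUT.HodgeTheaters.IsTorsor.labelEquiv
example := @Literature.IUT.HodgeTheaters.IsTorsor.pointedEquiv

/-- [node IUTchI:Rmk4.2.1 · L5/D2 · [IUTchI] Rmk 4.2.1, kurims p.98 · p403780 · claim] decls 1 · cites→ IUTchI:Def4.1,IUTchI:Ex3.3,IUTchI:Ex3.4,IUTchI:Prop4.2 -/
abbrev N_IUTchI_Rmk4_2_1 : Prop := StatementOf @Literature.IUT.HodgeTheaters.no_compatible_bijection.{u₁, u₂, u₃}
/-- partial witness (DAG row not marked discharged) of `N_IUTchI_Rmk4_2_1`: the landed theorems it names, BY NAME (spec §2(c)); proves nothing new. -/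
theorem N_IUTchI_Rmk4_2_1_part : N_IUTchI_Rmk4_2_1 := @Literature.IUT.HodgeTheaters.no_compatible_bijection

/-- [node IUTchI:Ex4.4(i) · L5/D2 · [IUTchI] Ex 4.4 (i), kurims p.105 · p403780 · claim] decls 7 · cites→ IUTchI:Def4.6,IUTchI:Ex3.2,IUTchI:Ex4.3,IUTchI:Prop4.2 -/
def N_IUTchI_Ex4_4_i : Prop :=
  StatementOf @Literature.IUT.HodgeTheaters.FlAbs.mk_eq_mk_iff ∧
  StatementOf @Literature.IUT.HodgeTheaters.FlStar.toFlAbs_injective ∧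
  StatementOf @Literature.IUT.HodgeTheaters.FlStar.toFlAbs_ne_zero ∧
  StatementOf @Literature.IUT.HodgeTheaters.FlAbs.eq_zero_or_exists_eq
/-- partial witness (DAG row not marked discharged) of `N_IUTchI_Ex4_4_i`: the landed theorems it names, BY NAME (spec §2(c)); proves nothing new. -/
theorem N_IUTchI_Ex4_4_i_part : N_IUTchI_Ex4_4_i := ⟨@Literature.IUT.HodgeTheaters.FlAbs.mk_eq_mk_iff, @Literature.IUT.HodgeTheaters.FlStar.toFlAbs_injective, @Literature.IUT.HodgeTheaters.FlStar.toFlAbs_ne_zero, @Literature.IUT.HodgeTheaters.FlAbs.eq_zero_or_exists_eq⟩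
example := @Literature.IUT.HodgeTheaters.FlAbs
example := @Literature.IUT.HodgeTheaters.FlAbs.zero
example := @Literature.IUT.HodgeTheaters.flAbsEquivOption

end

end Summit.ABC.IUTFork.DAG
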